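import Mathlib
import Summits.Ventures.HodgeRepro2.T6N41Glue

/-!
# T6N41Shapes — the printed shapes of the local L-factors discharge the (P2) binders (pre-M2, carrier-free)

Record: route/T5-N4.1-route-1.md v6.7 (N4.1.3) step (P2) — «Each factor `L(s, π_v × χ_{V,v})`, `v ∈ S`, is a
meromorphic function with no zeros (Γ-product at real `v`; `1/P_v(q_v^{−s})` at finite `v`)» — and (P3)/T5
col. 4 for the removed Hecke factors `(1 − η(ϖ_v) q_v^{−s})⁻¹`.  At M2 the Lapid–Rallis displays (N41-H2)
will state the SHAPES as printed; this file turns a shape into the `hS` binder of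
`T6N41Euler.R1_of_eulerProducts` («meromorphic on `ℂ` and of order `≤ 0` at `x`»):

* finite place: `L s = (P(q^{-s}))⁻¹` with `P` a polynomial, `P(0) = 1`, `q > 1` ⟹ `finitePlace_hyp`;
* archimedean place: `L s = E s · ∏_j Γ(a_j s + b_j)` with `E` entire and non-vanishing (e.g. the
  `c · A^{-s}` prefactors of `Γ_ℝ`, `Γ_ℂ`: `analyticOnNhd_const_mul_cpow`, `const_mul_cpow_ne_zero`) and
  `a_j ≠ 0` ⟹ `archimedeanPlace_hyp`;
* the unramified doubling factor `(1 − a₁ q^{-s})⁻¹ (1 − a₂ q^{-s})⁻¹` is the finite-place shape with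
  `P = (1 − a₁ X)(1 − a₂ X)`: `unramified_eq_inv_eval`.

Nothing is displayed here (TARGET-T6 §7(c)).  §8(d): uses an L-value-free non-vanishing device: NO.
-/

namespace Summit.Ventures.HodgeRepro2.T6
namespace N41Core

open Filter Topology
open Summit.Ventures.HodgeRepro2.T5OrderCounting

/-! ### Finite places -/

/-- A polynomial with constant coefficient `1` is non-zero. -/
theorem ne_zero_of_coeff_zero_eq_one {P : Polynomial ℂ} (hP0 : P.coeff 0 = 1) : P ≠ 0 := by
  intro h
  rw [h, Polynomial.coeff_zero] at hP0
  exact zero_ne_one hP0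

/-- The finite-place shape `L s = (P(q^{-s}))⁻¹` is meromorphic on `ℂ`. -/
theorem meromorphicOn_of_finitePlaceShape {q : ℝ} (hq : 0 < q) {L : ℂ → ℂ} (P : Polynomial ℂ)
    (hL : ∀ s, L s = (P.eval ((q : ℂ) ^ (-s)))⁻¹) : MeromorphicOn L Set.univ := by
  rw [funext hL]
  exact meromorphicOn_inv_eval_cpow P hq

/-- The finite-place shape `L s = (P(q^{-s}))⁻¹`, `P(0) = 1`, `q > 1`, has order `≤ 0` at every point. -/
theorem meromorphicOrderAt_le_zero_of_finitePlaceShape {q : ℝ} (hq : 1 < q) {L : ℂ → ℂ}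
    {P : Polynomial ℂ} (hP0 : P.coeff 0 = 1) (hL : ∀ s, L s = (P.eval ((q : ℂ) ^ (-s)))⁻¹) (x : ℂ) :
    meromorphicOrderAt L x ≤ 0 := by
  rw [funext hL]
  exact meromorphicOrderAt_inv_eval_cpow_le_zero (ne_zero_of_coeff_zero_eq_one hP0) hq x

/-- (P2) at a finite place: the `hS` binder of `R1_of_eulerProducts` from the Lapid–Rallis shape. -/
theorem finitePlace_hyp {q : ℝ} (hq : 1 < q) {L : ℂ → ℂ} {P : Polynomial ℂ} (hP0 : P.coeff 0 = 1)
    (hL : ∀ s, L s = (P.eval ((q : ℂ) ^ (-s)))⁻¹) (x : ℂ) :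
    MeromorphicOn L Set.univ ∧ meromorphicOrderAt L x ≤ 0 :=
  ⟨meromorphicOn_of_finitePlaceShape (zero_lt_one.trans hq) P hL,
    meromorphicOrderAt_le_zero_of_finitePlaceShape hq hP0 hL x⟩

/-- The unramified doubling factor `(1 − a₁ q^{-s})⁻¹ (1 − a₂ q^{-s})⁻¹` (Bump (5.23) for the principal
series `i(η₁, η₂)`) is the finite-place shape with `P = (1 − a₁ X)(1 − a₂ X)`. -/
theorem unramified_eq_inv_eval (a₁ a₂ : ℂ) (z : ℂ) :
    (1 - a₁ * z)⁻¹ * (1 - a₂ * z)⁻¹ =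
      (((1 - Polynomial.C a₁ * Polynomial.X) * (1 - Polynomial.C a₂ * Polynomial.X)).eval z)⁻¹ := by
  rw [Polynomial.eval_mul, mul_inv]
  simp

/-- `(1 − a₁ X)(1 − a₂ X)` has constant coefficient `1`. -/
theorem coeff_zero_unramified (a₁ a₂ : ℂ) :
    ((1 - Polynomial.C a₁ * Polynomial.X) * (1 - Polynomial.C a₂ * Polynomial.X)).coeff 0 = 1 := by
  simp [Polynomial.mul_coeff_zero]

/-! ### Archimedean places -/

/-- The prefactor `s ↦ c · A^{-s}` (`A > 0` real) is entire. -/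
theorem analyticOnNhd_const_mul_cpow (c : ℂ) {A : ℝ} (hA : 0 < A) :
    AnalyticOnNhd ℂ (fun s : ℂ => c * (A : ℂ) ^ (-s)) Set.univ := fun _ _ =>
  analyticAt_const.mul (analyticAt_const.cpow analyticAt_id.neg (Complex.ofReal_mem_slitPlane.2 hA))

/-- The prefactor `s ↦ c · A^{-s}` (`c ≠ 0`, `A > 0`) never vanishes. -/
theorem const_mul_cpow_ne_zero {c : ℂ} (hc : c ≠ 0) {A : ℝ} (hA : 0 < A) (s : ℂ) :
    c * (A : ℂ) ^ (-s) ≠ 0 := by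
  refine mul_ne_zero hc ?_
  rw [Ne, Complex.cpow_eq_zero_iff]
  exact fun h => (Complex.ofReal_ne_zero.2 hA.ne') h.1

/-- The archimedean shape `s ↦ E s · ∏_j Γ(a_j s + b_j)`, as a product of functions. -/
theorem gammaProduct_eq {n : ℕ} (a b : Fin n → ℂ) (E : ℂ → ℂ) :
    (fun s : ℂ => E s * ∏ j, Complex.Gamma (a j * s + b j)) =
      E * ∏ j, (fun s : ℂ => Complex.Gamma (a j * s + b j)) := by
  funext s
  simp [Finset.prod_apply]

/-- The archimedean shape is meromorphic on `ℂ` for every entire prefactor `E`. -/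
theorem meromorphicOn_gammaProduct {n : ℕ} (a b : Fin n → ℂ) {E : ℂ → ℂ}
    (hE : AnalyticOnNhd ℂ E Set.univ) :
    MeromorphicOn (fun s : ℂ => E s * ∏ j, Complex.Gamma (a j * s + b j)) Set.univ := by
  rw [gammaProduct_eq]
  exact hE.meromorphicOn.mul (meromorphicOn_prod fun j _ => meromorphicOn_Gamma_affine (a j) (b j))

/-- The archimedean shape has order `≤ 0` at every point when `E` is entire and non-vanishing and every
`a_j ≠ 0` (Γ has no zeros). -/
theorem meromorphicOrderAt_gammaProduct_le_zero {n : ℕ} {a : Fin n → ℂ} (ha : ∀ j, a j ≠ 0)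
    (b : Fin n → ℂ) {E : ℂ → ℂ} (hE : AnalyticOnNhd ℂ E Set.univ) (hE0 : ∀ s, E s ≠ 0) (x : ℂ) :
    meromorphicOrderAt (fun s : ℂ => E s * ∏ j, Complex.Gamma (a j * s + b j)) x ≤ 0 := by
  rw [gammaProduct_eq, meromorphicOrderAt_mul (hE x trivial).meromorphicAt
    (MeromorphicAt.prod fun j _ => meromorphicAt_Gamma_affine (a j) (b j) x),
    meromorphicOrderAt_eq_zero_of_ne_zero (hE x trivial) (hE0 x), zero_add]
  exact meromorphicOrderAt_prod_nonpos (fun j _ => meromorphicAt_Gamma_affine (a j) (b j) x)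
    (fun j _ => meromorphicOrderAt_Gamma_affine_le_zero (ha j) (b j) x)

/-- (P2) at an archimedean place: the `hS` binder of `R1_of_eulerProducts` from the Γ-product shape. -/
theorem archimedeanPlace_hyp {n : ℕ} {a : Fin n → ℂ} (ha : ∀ j, a j ≠ 0) (b : Fin n → ℂ) {E : ℂ → ℂ}
    (hE : AnalyticOnNhd ℂ E Set.univ) (hE0 : ∀ s, E s ≠ 0) {L : ℂ → ℂ}
    (hL : ∀ s, L s = E s * ∏ j, Complex.Gamma (a j * s + b j)) (x : ℂ) :
    MeromorphicOn L Set.univ ∧ meromorphicOrderAt L x ≤ 0 := by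
  rw [funext hL]
  exact ⟨meromorphicOn_gammaProduct a b hE, meromorphicOrderAt_gammaProduct_le_zero ha b hE hE0 x⟩

end N41Core
end Summit.Ventures.HodgeRepro2.T6
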